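import Summits.QuantumAdvantage.AdviceFreeQNC0.KFeatureWindow
import HarnessLib

/-!
# Cell qa-qnc0 (rung F-Q1, route RingFrame, crux α `RingToElim`): ADDITIVELY SEPARABLE
# CROSS-READING is beaten (corollary (a) of planner qa-qnc0-p1's T9, ask P13)

The K-feature window theorem (`kFeatureWindowSqrt`, `KFeatureWindow.lean`) beats every walk
strategy whose cuts strictly inside the `z`-block of a window `x ++ h ++ z` read the `x`-block only
through `K` low-degree features with `K·D ≤ c₁√L`.  The simplest genuinely CROSS-READING instance
(ROUND-10 §3 / Sketch11 §23.5: "per-fibre `x|z` cross-rank `≤ K` — e.g. additively separable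
cross-reading — is new"):

* `ringWinU_sepCrossReading_sqrt_le` — if on every fibre `(a, h, b)` each cut `g` strictly inside
  the `z`-block splits ADDITIVELY, `y_g(a ++ x ++ h ++ z ++ b) = F_g(z) ⊕ γ_g(x)` with `γ_g` of
  degree `≤ D` (and `F_g` arbitrary), then — with the budget `(M − 1)·D ≤ c₁√L`, `D ≤ c₁√M`,
  `L, M ≥ n₀` — the strategy wins on at most `θ·2ⁿ` inputs (`θ = 1 − κ₀η₀` of T9).  The features
  are the `M − 1` functions `γ_g`; every interior cut may read ALL of `x` (through its own `γ_g`)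
  and all of `z`.

The cell's theorem (planner qa-qnc0-p1 gen 11, statement in prose; prover qn-prover-3 gen 4),
2026-08-27; not in print.  WHAT THIS IS NOT: multiplicatively entangled cross-reading (α proper)
is untouched; the budget forces `L ≳ M²D²`; no separation.
-/

noncomputable section

namespace Summit.QuantumAdvantage.AdviceFreeQNC0

open Finset
open Literature.Computability.MetaComplexity Literature.Computability.MetaComplexity.Smolensky

/-- **Additively separable cross-reading is beaten.**  There are `θ < 1`, `c₁ > 0`, `n₀` such
that for all `p, L, H, M, q` with `L, M ≥ n₀`, every `D ≤ c₁√M` with `(M − 1)·D ≤ c₁√L`, every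
charge and every walk strategy on `p + (L + H + M) + q` bits with all selectors of degree `≤ D`
such that, on every fibre `(a, h, b)`, each cut strictly inside the `z`-block is the XOR of a
function of `z` and a function of `x` of degree `≤ D`: the ring game in walk coordinates is won
on at most `θ·2ⁿ` inputs. [cite: Srinivasan2023, Lemma 3.1] -/
theorem ringWinU_sepCrossReading_sqrt_le :
    ∃ θ : ℝ, θ < 1 ∧ ∃ c₁ : ℝ, 0 < c₁ ∧ ∃ n₀ : ℕ, ∀ p L H M q : ℕ, n₀ ≤ L → n₀ ≤ M →
      ∀ D : ℕ, (D : ℝ) ≤ c₁ * Real.sqrt M → (((M - 1) * D : ℕ) : ℝ) ≤ c₁ * Real.sqrt L →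
      ∀ (c : ℕ) (y : Fin (p + (L + H + M) + q + 1) → (Fin (p + (L + H + M) + q) → Bool) → Bool),
        (∀ g, HasDeg (y g) D) →
        (∀ (a : Fin p → Bool) (h : Fin H → Bool) (b : Fin q → Bool),
          ∀ g : Fin (p + (L + H + M) + q + 1), p + (L + H) < g.val → g.val < p + (L + H + M) →
            ∃ F : (Fin M → Bool) → Bool, ∃ γ : (Fin L → Bool) → Bool, HasDeg γ D ∧
              ∀ (x : Fin L → Bool) (z : Fin M → Bool),
                y g (glue3 a (glue3 x h z) b) = xor (F z) (γ x)) →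
        ((univ.filter fun u : Fin (p + (L + H + M) + q) → Bool => ringWinU c y u = true).card : ℝ) ≤
          θ * (2 : ℝ) ^ (p + (L + H + M) + q) := by
  classical
  obtain ⟨θ, hθ, c₁, hc₁, n₀, HT⟩ := kFeatureWindowSqrt
  refine ⟨θ, hθ, c₁, hc₁, n₀, ?_⟩
  intro p L H M q hL hM D hD hKD c y hdeg hsep
  refine HT p L H M q (M - 1) hL hM D hD hKD c y hdeg fun a h b => ?_
  choose F γ hγ hFγ using hsep a h b
  -- the features: `γ_g` for the interior cuts `g = p + L + H + 1 + k`, `k < M - 1`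
  refine ⟨fun k x => γ ⟨p + (L + H) + 1 + k.val, by omega⟩ (by simp; omega) (by simp; omega) x,
    fun k => hγ _ _ _, ?_⟩
  intro g h1 h2 x x' z hxx'
  have hk : g.val - (p + (L + H) + 1) < M - 1 := by omega
  have key := hxx' ⟨g.val - (p + (L + H) + 1), hk⟩
  have hgeq : g = ⟨p + (L + H) + 1 + (g.val - (p + (L + H) + 1)), by omega⟩ :=
    Fin.ext (show g.val = p + (L + H) + 1 + (g.val - (p + (L + H) + 1)) by omega)
  have p1 : p + (L + H) < (⟨p + (L + H) + 1 + (g.val - (p + (L + H) + 1)), by omega⟩ :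
      Fin (p + (L + H + M) + q + 1)).val :=
    show p + (L + H) < p + (L + H) + 1 + (g.val - (p + (L + H) + 1)) by omega
  have p2 : (⟨p + (L + H) + 1 + (g.val - (p + (L + H) + 1)), by omega⟩ :
      Fin (p + (L + H + M) + q + 1)).val < p + (L + H + M) :=
    show p + (L + H) + 1 + (g.val - (p + (L + H) + 1)) < p + (L + H + M) by omega
  rw [hgeq, hFγ _ p1 p2 x z, hFγ _ p1 p2 x' z]
  exact congrArg (fun bx : Bool => xor (F _ p1 p2 z) bx) key

end Summit.QuantumAdvantage.AdviceFreeQNC0
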